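import Summits.PneNP.PneNP.Theorems.SymmetryBudgetNoHiddenOrderPerPathCGProcess
import Summits.PneNP.PneNP.Theorems.SymmetryBudgetNoHiddenOrderCertifiedDecoding

/-!
# The certified-label scheme is COMPLETE and SOUND on the concrete Corneil–Goldberg process (`NoHiddenOrder`, glue g1–g2)

Route `PneNP/SymmetryBudget`, `NoHiddenOrder` (stmt-PneNP-14781). `…PerPathCGProcess.lean` instantiates the abstract certified-label
scheme (`…CertifiedScheme*.lean`, ANALYSIS-4 §2) with the components-only Corneil–Goldberg recursion (`cgProcess`, `cgValuation`).
Here the STRUCTURAL hypotheses of its completeness theorem `CertifiedLabels.val_complete_replay` are discharged for that process,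
from any start instance `I₀` and for any child selector taking its vertex in the first smallest cell (`cgSel`):

* `singleton_named_of_reach` (g1) — along the solution subtree every already-named vertex still present is ALONE IN ITS CELL
  (individualised vertices stay singletons under refinement and restriction); hence `cgSel_fresh`: the selected vertex is new;
* `cgStep_cgChild_sel_eq_andNode` — the child of an individualisation node is a section node (the new singleton is switching-
  isolated, `not_swAdj_of_cell_singleton`, its colouring being equitable inside the block, `equitableIn_refineIn`); hence every
  individualisation node strictly below has a strictly smaller block (`card_lt_of_reachFrom_child`), so BLOCK SIZE is an
  anti-layering value function: (C1′) holds for `hv I := |block I|` with value range `|V| + 1` (g2, the budget-free choice; the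
  budgeted choice — pass-over heights — is the remaining glue g3);
* `cg_val_ne_none_of_reach` — completeness modulo admissibility; `cg_root_value` — with everything admissible the ROOT GROUP OUTPUTS
  A COPY OF THE START BLOCK read along an enumeration (completeness + `cg_val_sound` + the root replays to itself).

So, kernel-checked end to end at the function level: replay-decoded, certified label groups over the real process compute an
adjacency matrix of a relabelling of the input. What is not here: the label BUDGET (heights, g3) and the symmetric compilation (R2c).
-/

-- `Summit.PneNP.PneNP.…` duplicates `PneNP` BY DESIGN (single-problem summit, D-0017 layout).
set_option linter.dupNamespace false

namespace Summit.PneNP.PneNP.Theorems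

open Finset

namespace BranchSum

variable {V : Type*} [DecidableEq V] (G : SimpleGraph V) [DecidableRel G.Adj]

/-- A child SELECTOR: a vertex of the first smallest cell (any, by choice), else any vertex of the block. -/
noncomputable def cgSel (I : CGInst V) : V :=
  if h : (smallestCell I.1.1 I.1.2).Nonempty then h.choose else I.2.choose

variable {G}

/-- At an individualisation node the selector selects inside the cell. -/
theorem cgSel_mem (I : CGInst V) (A : Finset V) (ch : V → CGInst V) (hs : cgStep G I = .orNode A ch) : cgSel I ∈ A := by
  obtain ⟨-, ⟨-, h2⟩, rfl, -⟩ := cgStep_eq_orNode_iff.1 hs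
  have hne : (smallestCell I.1.1 I.1.2).Nonempty := card_pos.1 (by omega)
  unfold cgSel
  rw [dif_pos hne]
  exact hne.choose_spec

/-! ### g1: named vertices are singletons; freshness -/

/-- Along the solution subtree from a start with no named vertices, every named vertex still in the block is alone in its
cell. -/
theorem singleton_named_of_reach {sel : CGInst V → V} (hsel : ∀ I A ch, cgStep G I = .orNode A ch → sel I ∈ A)
    {hv : CGInst V → ℕ} {I₀ I : (cgProcess G).Inst} {X : Finset V} {lam : V → ℕ} (h : CertifiedLabels.Reach (cgProcess G) sel hv I₀ I X lam) :
    ∀ x ∈ X, x ∈ I.1.1 → cellOf I.1.1 I.1.2 x = {x} := by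
  induction h with
  | root => intro x hx; exact absurd hx (notMem_empty x)
  | @part I X lam ps J _ hs hJ ih =>
    intro x hx hxJ
    change CGInst V at I J
    obtain ⟨-, rfl⟩ := cgStep_eq_andNode_iff.1 hs
    obtain ⟨hcol, hK⟩ := mem_cgParts_iff.1 hJ
    obtain ⟨w, -, hw⟩ := mem_image.1 hK
    have hJI : J.1.1 ⊆ I.1.1 := hw ▸ swReach_subset _ _ w
    have hI := ih x hx (hJI hxJ)
    refine eq_singleton_iff_unique_mem.2 ⟨mem_cellOf_iff.2 ⟨hxJ, rfl⟩, fun y hy => ?_⟩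
    rw [mem_cellOf_iff, hcol] at hy
    have : y ∈ cellOf I.1.1 I.1.2 x := mem_cellOf_iff.2 ⟨hJI hy.1, hy.2⟩
    rw [hI] at this
    exact mem_singleton.1 this
  | @child I X lam A ch _ hs ih =>
    intro x hx hxC
    change CGInst V at I
    obtain ⟨-, -, rfl, rfl⟩ := cgStep_eq_orNode_iff.1 hs
    have hselA : sel I ∈ I.1.1 := smallestCell_subset _ _ (hsel I _ _ hs)
    change x ∈ I.1.1 at hxC
    change cellOf I.1.1 (refineIn G I.1.1 (indiv I.1.2 (sel I))) x = {x}
    rcases mem_insert.1 hx with rfl | hx'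
    · exact cellOf_refineIn_indiv I.1.2 hselA
    · have hI := ih x hx' hxC
      refine eq_singleton_iff_unique_mem.2 ⟨mem_cellOf_iff.2 ⟨hxC, rfl⟩, fun y hy => ?_⟩
      rw [mem_cellOf_iff] at hy
      have hyx : I.1.2 y = I.1.2 x := indiv_refines _ _ (refineIn_refines (G := G) _ hy.1 hxC hy.2)
      have : y ∈ cellOf I.1.1 I.1.2 x := mem_cellOf_iff.2 ⟨hy.1, hyx⟩
      rw [hI] at this
      exact mem_singleton.1 this

/-- **Freshness**: the vertex selected at an individualisation node of the solution subtree has not been named before. -/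
theorem cgSel_fresh {sel : CGInst V → V} (hsel : ∀ I A ch, cgStep G I = .orNode A ch → sel I ∈ A) {hv : CGInst V → ℕ}
    {I₀ : CGInst V} (I : CGInst V) (X : Finset V) (lam : V → ℕ) (A : Finset V) (ch : V → CGInst V)
    (h : CertifiedLabels.Reach (cgProcess G) sel hv I₀ I X lam) (hs : cgStep G I = .orNode A ch) : sel I ∉ X := by
  intro hX
  obtain ⟨-, ⟨-, h2⟩, rfl, -⟩ := cgStep_eq_orNode_iff.1 hs
  have hmem := hsel I _ _ hs
  have hsingle := singleton_named_of_reach hsel h (sel I) hX (smallestCell_subset _ _ hmem)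
  rw [smallestCell_eq_cellOf _ hmem, hsingle, card_singleton] at h2
  omega

/-! ### g2: the child of an individualisation node is a section node; block size is an anti-layering value -/

/-- The child at a vertex of a block with `≥ 2` vertices is a SECTION node: the individualised singleton is switching-isolated. -/
theorem cgStep_cgChild_eq_andNode (I : CGInst V) {x : V} (hx : x ∈ I.1.1) (h2 : 1 < I.1.1.card) :
    cgStep G (cgChild G I x) = .andNode (cgParts G (cgChild G I x)) := by
  rw [cgStep_eq_andNode_iff]
  refine ⟨⟨x, hx, fun heq => ?_⟩, rfl⟩
  set cs := refineIn G I.1.1 (indiv I.1.2 x) with hcs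
  have hsingle : cellOf I.1.1 cs x = {x} := cellOf_refineIn_indiv I.1.2 hx
  have hequit : ∀ u ∈ I.1.1, ∀ v ∈ I.1.1, cs u = cs v → ∀ w ∈ I.1.1,
      ((cellOf I.1.1 cs w).filter fun y => G.Adj u y).card = ((cellOf I.1.1 cs w).filter fun y => G.Adj v y).card :=
    fun u hu v hv huv w hw => equitableIn_refineIn I.1.1 (indiv I.1.2 x) hu hv huv hw
  have hiso : ∀ b ∈ I.1.1, ¬ (swGraph G I.1.1 cs).Adj x b := fun b hb => not_swAdj_of_cell_singleton hequit hx hsingle hb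
  have hsub : swReach G I.1.1 cs x ⊆ {x} :=
    swReach_subset_of_closed cs (mem_singleton_self x) fun a ha b hb hab => by
      rw [mem_singleton] at ha; subst ha; exact absurd hab (hiso b hb)
  have := card_le_card hsub
  change swReach G I.1.1 cs x = I.1.1 at heq
  rw [heq, card_singleton] at this
  omega

/-- Below the child of an individualisation node, every individualisation node has a strictly smaller block. -/
theorem card_lt_of_reachFrom_child {sel : CGInst V → V} (hsel : ∀ I A ch, cgStep G I = .orNode A ch → sel I ∈ A)
    {hv : CGInst V → ℕ} (I : CGInst V) (A : Finset V) (ch : V → CGInst V) (hs : cgStep G I = .orNode A ch)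
    {β : CGInst V} {Xβ : Finset V} {lamβ : V → ℕ} {Aβ : Finset V} {chβ : V → CGInst V} {X' : Finset V} {lam' : V → ℕ}
    (hR : CertifiedLabels.ReachFrom (P := cgProcess G) sel hv (ch (sel I)) X' lam' β Xβ lamβ)
    (hβ : cgStep G β = .orNode Aβ chβ) :
    β.1.1.card < I.1.1.card := by
  obtain ⟨-, ⟨h2, -⟩, rfl, rfl⟩ := cgStep_eq_orNode_iff.1 hs
  have hselA : sel I ∈ I.1.1 := smallestCell_subset _ _ (hsel I _ _ hs)
  have hAND := cgStep_cgChild_eq_andNode (G := G) I hselA h2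
  have hverts : ∀ J A' ch', (cgProcess G).step J = .orNode A' ch' → (cgProcess G).verts (ch' (sel J)) = (cgProcess G).verts J := by
    intro J A' ch' hJ
    obtain ⟨-, -, -, rfl⟩ := cgStep_eq_orNode_iff.1 hJ
    rfl
  rcases hR with _ | ⟨hs', hJ, htail⟩ | ⟨hs', -⟩
  · exact absurd (hAND.symm.trans hβ) (by simp)
  · obtain ⟨hdisc, hps⟩ := cgStep_eq_andNode_iff.1 hs'
    subst hps
    have h1 : β.1.1 ⊆ _ := htail.verts_subset hverts
    have h2' := cgParts_ssubset hdisc hJ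
    exact (card_le_card h1).trans_lt (card_lt_card h2')
  · exact absurd (hAND.symm.trans hs') (by simp)

/-! ### Completeness and the root value -/

/-- **Completeness of the certified-label scheme on the concrete process, modulo admissibility** (values = block sizes,
value range `|V| + 1`): every group of the solution subtree outputs a value. -/
theorem cg_val_ne_none_of_reach [Fintype V] (adm : CertifiedLabels.Label V → Prop) (I₀ : CGInst V)
    (hadm : ∀ I X lam, CertifiedLabels.Reach (cgProcess G) (cgSel (V := V)) (fun I => I.1.1.card) I₀ I X lam →
      adm ⟨I.1.1, X, lam⟩)
    (I : CGInst V) (X : Finset V) (lam : V → ℕ)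
    (h : CertifiedLabels.Reach (cgProcess G) (cgSel (V := V)) (fun I => I.1.1.card) I₀ I X lam) :
    CertifiedLabels.val (cgProcess G) (cgValuation G) (fun L => CertifiedLabels.replay (cgProcess G) L I₀ ∅) adm
      (Fintype.card V + 1) ⟨I.1.1, X, lam⟩ ≠ none := by
  refine CertifiedLabels.val_complete_replay (cgValuation G) adm _ (cgSel (V := V)) (fun I => I.1.1.card) I₀ cgSel_mem
    (fun I _ _ _ => Nat.lt_succ_of_le (card_le_univ _)) (fun I A ch hs => ?_) (fun I X lam A ch hR hs => ?_) hadm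
    cgStep_parts_disjoint verts_nonempty (fun I X lam A ch _ hs β Xβ lamβ Aβ chβ hR hβ _ => ?_) I X lam h
  · obtain ⟨-, -, -, rfl⟩ := cgStep_eq_orNode_iff.1 hs
    rfl
  · exact cgSel_fresh cgSel_mem I X lam A ch hR hs
  · exact card_lt_of_reachFrom_child cgSel_mem I A ch hs hR hβ

/-- The root label replays to the root. -/
theorem replay_root_label [Fintype V] (I₀ : CGInst V) :
    CertifiedLabels.replay (cgProcess G) ⟨I₀.1.1, ∅, fun _ => 0⟩ I₀ ∅ = some I₀ := by
  rw [CertifiedLabels.replay]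
  split_ifs with h
  · rfl
  · exact absurd ⟨rfl, rfl⟩ h

/-- **The root group outputs a copy of the start block** (all labels admissible, values = block sizes): the certified-label scheme
over the components-only Corneil–Goldberg process, decoded by replay, computes at the root the copy of `(A₀, col₀)` read along some
enumeration of `A₀` — an adjacency matrix of a relabelling of the input block. -/
theorem cg_root_value [Fintype V] (I₀ : CGInst V) :
    ∃ E : Enc, CertifiedLabels.val (cgProcess G) (cgValuation G) (fun L => CertifiedLabels.replay (cgProcess G) L I₀ ∅)
        (fun _ => True) (Fintype.card V + 1) ⟨I₀.1.1, ∅, fun _ => 0⟩ = some E ∧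
      ∃ l : List V, l.Nodup ∧ l.toFinset = I₀.1.1 ∧ E = encOf G I₀.1.2 l := by
  have hne := cg_val_ne_none_of_reach (G := G) (fun _ => True) I₀ (fun _ _ _ _ => trivial) I₀ ∅ (fun _ => 0)
    CertifiedLabels.Reach.root
  obtain ⟨E, hE⟩ := Option.ne_none_iff_exists'.1 hne
  refine ⟨E, hE, ?_⟩
  obtain ⟨I, hI, l, hl, hlI, hEl⟩ := cg_val_sound _ _ _ _ E hE
  rw [replay_root_label] at hI
  cases hI
  exact ⟨l, hl, hlI, hEl⟩

end BranchSum

end Summit.PneNP.PneNP.Theorems
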